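import Summits.QuantumFields.YangMills.Theorems.PoincareLipschitzTangentMapDensityCapHolds
import Summits.QuantumFields.YangMills.Theorems.PoincareLipschitzConeLinkDilation
import Summits.QuantumFields.YangMills.Theorems.PoincareLipschitzGapOfHSystemQuantizationCloses
import Literature.Analysis.PDE.HarmonicMapMinimisers
import Mathlib.MeasureTheory.Measure.Haar.NormedSpace
import HarnessLib

/-!
# Crux `BlockLipschitzL` (stmt-QuantumFields-23533) ∕ `HistoryTailL` (stmt-QuantumFields-19936), LINE 25 «CompactnessTransfer»,
# the (TM) road — FILE TM-BRIDGE «THE LITERATURE FACT `MinimisingTangentMapConstant` [SU84 Prop. 1.2] FROM THE `8π`-GAP ROW»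

Cell `ym3-torus` (YM ladder rung R3 = continuum SU(2) Yang–Mills on T³ — a RUNG, NOT Clay: not d = 4, not infinite volume,
not a mass gap); WIDTH helper seat `ym3-torus-px16` g10; `--supports stmt-QuantumFields-23533`; THEOREMS ONLY (0 `def`, 0 `sorry`,
default heartbeats); imports px3 g9's ✓`…TangentMapDensityCapHolds` (★★★★ `centralDensity_le_three_pi_holds`, hypothesis-free), px14
g7's ✓`…ConeLinkDilation` (★★★ `ae_eq_smul_weakGrad_comp_inv_smul`: the weak gradient of a radially constant map is homogeneous of
degree `−1`), lit `HarmonicMapMinimisers` (the named fact `MinimisingTangentMapConstant`), Mathlib.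

WHAT THIS FILE PROVES.  ★★★ `minimisingTangentMapConstant_of_gap (hGap)` : **(GAP) ⟹ (TM)** — the `8π`-gap row «a class member with
linear central energies of slope `Θ ≤ 3π` has `Θ = 0`» (px3 g9's frozen text 30a3f455, = the binder of ✓`uniformSmallScaleEnergy_band_of_gap`)
IMPLIES the Literature named fact `Literature.Analysis.PDE.MinimisingTangentMapConstant` [SchoenUhlenbeck1984, Prop. 1.2: minimizing
tangent maps `ℝ³ → S³` are constant], read on the cube: (1) the cube is star-shaped, so radial constancy `G x x = 0` a.e. makes `G`
homogeneous of degree `−1` (px14); (2) hence the central energies are EXACTLY linear, `E(B_r(0)) = Θ·r` for `0 < r ≤ 1`, `Θ := E(B_1(0))`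
(change of variables `x ↦ s⁻¹x`, ★ `ballEnergy_linear`); (3) the hypothesis-free density cap (px3) gives `Θ ≤ 3π`; (4) (GAP) gives
`Θ = 0`, so `G = 0` a.e. on `B_1(0)`; (5) homogeneity at `s = 2` carries this to the whole cube (`½Q ⊆ B_1(0)`, null sets pull back under
the homothety).  CONSEQUENCES (appended as their inputs land): with px19 g8's ROAD (H) closer `gap_of_hSystemQuantization (hF)`, (TM) ⟸ (F)
= [BrezisCoron1985, Lemma A.1] — one printed lemma of a different kind (energy quantization of the H-system); and the day a
hypothesis-free proof of (GAP) lands (ROAD (W)), `MinimisingTangentMapConstant_holds` is one line from this file.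

HONEST SCOPE.  A bridge between two statements; (GAP), (F), (TM) are NOT proved unconditionally here; S1″, K1, `MeanDeviationL`,
`BlockLipschitzL`, `HistoryTailL` NOT proved by this file.  YM₃ on T³ is rung R3, not Clay; YM gap NOT proved; no summit statement is
proved here.

References: R. Schoen, K. Uhlenbeck, Invent. Math. 78 (1984) 89–100 [SchoenUhlenbeck1984] (Prop. 1.2, Lemma 1.1); L. Simon (1996)
[Simon1996] (§3.1: tangent maps are homogeneous of degree zero); H. Brezis, J.-M. Coron (1985) [BrezisCoron1985] (Lemma A.1).
-/

set_option autoImplicit false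

noncomputable section

open MeasureTheory Set Function Filter Topology Metric TopologicalSpace
open scoped BigOperators Topology Pointwise

namespace Summit.QuantumFields.YangMills.Theorems.PoincareLipschitzTangentMapConstantOfGap

open Literature.Analysis.FunctionSpaces (HasWeakFDerivOn)
open Summit.QuantumFields.YangMills.Theorems.PoincareLipschitzTangentMapDensityCapHolds (centralDensity_le_three_pi_holds)
open Summit.QuantumFields.YangMills.Theorems.PoincareLipschitzConeLinkDilation (ae_eq_smul_weakGrad_comp_inv_smul)

/-! ## §1 Letters: the cube is star-shaped; a vanishing Dirichlet density means a vanishing gradient -/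

/-- The open unit cube is star-shaped towards the origin: `s⁻¹ • x ∈ Q` for `x ∈ Q`, `s ≥ 1`. [folklore] -/
theorem inv_smul_mem_unitCube {x : EuclideanSpace ℝ (Fin 3)} (hx : ∀ i : Fin 3, |x i| < 1) {s : ℝ} (hs : 1 ≤ s) :
    ∀ i : Fin 3, |(s⁻¹ • x) i| < 1 := by
  intro i
  have hs0 : 0 < s := lt_of_lt_of_le one_pos hs
  rw [PiLp.smul_apply, smul_eq_mul, abs_mul, abs_of_pos (inv_pos.2 hs0)]
  calc s⁻¹ * |x i| ≤ 1 * |x i| := by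
        refine mul_le_mul_of_nonneg_right (inv_le_one_of_one_le₀ hs) (abs_nonneg _)
    _ < 1 := by rw [one_mul]; exact hx i

/-- `ball 0 r ⊆ Q` for `r ≤ 1`. [folklore] -/
theorem ball_subset_unitCube {r : ℝ} (hr : r ≤ 1) :
    ball (0 : EuclideanSpace ℝ (Fin 3)) r ⊆ {x : EuclideanSpace ℝ (Fin 3) | ∀ i : Fin 3, |x i| < 1} := by
  intro x hx i
  rw [mem_ball_zero_iff] at hx
  calc |x i| = ‖x i‖ := (Real.norm_eq_abs _).symm
    _ ≤ ‖x‖ := PiLp.norm_apply_le x i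
    _ < 1 := lt_of_lt_of_le hx hr

/-- Half the cube lies in the unit ball: `‖2⁻¹ • x‖ < 1` for `x ∈ Q` (`‖x‖² < 3 < 4`). [folklore] -/
theorem half_smul_mem_ball {x : EuclideanSpace ℝ (Fin 3)} (hx : ∀ i : Fin 3, |x i| < 1) :
    (2:ℝ)⁻¹ • x ∈ ball (0 : EuclideanSpace ℝ (Fin 3)) 1 := by
  rw [mem_ball_zero_iff, norm_smul, Real.norm_eq_abs, abs_of_pos (by norm_num : (0:ℝ) < 2⁻¹)]
  have hn : ‖x‖ ^ 2 = x 0 ^ 2 + x 1 ^ 2 + x 2 ^ 2 := by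
    rw [EuclideanSpace.norm_sq_eq, Fin.sum_univ_three]
    simp [Real.norm_eq_abs, sq_abs]
  have h0 := hx 0
  have h1 := hx 1
  have h2 := hx 2
  rw [abs_lt] at h0 h1 h2
  have h3 : ‖x‖ ^ 2 < 4 := by nlinarith
  have h4 : ‖x‖ < 2 := by nlinarith [norm_nonneg x]
  linarith

/-- **A vanishing Dirichlet density means a vanishing gradient**: `Σᵢ ‖G eᵢ‖² = 0 ⟹ G = 0` (expand in the standard basis).
[folklore] -/
theorem eq_zero_of_sum_norm_sq_eq_zero {G : EuclideanSpace ℝ (Fin 3) →L[ℝ] EuclideanSpace ℝ (Fin 4)}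
    (h : ∑ i : Fin 3, ‖G (EuclideanSpace.single i (1:ℝ))‖ ^ 2 = 0) : G = 0 := by
  have hi : ∀ i : Fin 3, G (EuclideanSpace.single i (1:ℝ)) = 0 := by
    intro i
    have h' := (Finset.sum_eq_zero_iff_of_nonneg fun j _ => sq_nonneg ‖G (EuclideanSpace.single j (1:ℝ))‖).1 h i
      (Finset.mem_univ i)
    exact norm_eq_zero.1 (pow_eq_zero_iff two_ne_zero |>.1 h')
  ext v j
  have hv : v = ∑ i : Fin 3, v i • EuclideanSpace.single i (1:ℝ) := by
    have hb := (EuclideanSpace.basisFun (Fin 3) ℝ).sum_repr v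
    simp only [EuclideanSpace.basisFun_apply, EuclideanSpace.basisFun_repr] at hb
    exact hb.symm
  rw [hv, map_sum]
  simp [map_smul, hi]

/-! ## §2 Exact linearity of the central energies of a radially constant class member -/

/-- ★ **HOMOGENEITY SCALES THE CENTRAL ENERGIES**: if `G (s⁻¹ • x) = s • G x` a.e. on the cube (`s ≥ 1`) and the density is
integrable on `Q`, then `E(B_{r∕s}(0)) = E(B_r(0)) ∕ s` for `0 < r ≤ 1` (change of variables `x ↦ s⁻¹x`, `dx ↦ s⁻³dx`,
density `↦ s²·`density). [cite: Simon1996, §3.1] -/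
theorem ballEnergy_div
    {G : EuclideanSpace ℝ (Fin 3) → (EuclideanSpace ℝ (Fin 3) →L[ℝ] EuclideanSpace ℝ (Fin 4))}
    {s : ℝ} (hs : 1 ≤ s)
    (hhom : ∀ᵐ x ∂(volume.restrict {x : EuclideanSpace ℝ (Fin 3) | ∀ i : Fin 3, |x i| < 1}), G (s⁻¹ • x) = s • G x)
    {r : ℝ} (hr1 : r ≤ 1) :
    ∫ x in ball (0 : EuclideanSpace ℝ (Fin 3)) (r / s), ∑ i : Fin 3, ‖G x (EuclideanSpace.single i (1:ℝ))‖ ^ 2 =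
      s⁻¹ * ∫ x in ball (0 : EuclideanSpace ℝ (Fin 3)) r, ∑ i : Fin 3, ‖G x (EuclideanSpace.single i (1:ℝ))‖ ^ 2 := by
  have hs0 : 0 < s := lt_of_lt_of_le one_pos hs
  have hsi : 0 < s⁻¹ := inv_pos.2 hs0
  -- change of variables `x ↦ s⁻¹ • x` on the ball of radius `r`
  have hcov := Measure.setIntegral_comp_smul_of_pos (μ := (volume : Measure (EuclideanSpace ℝ (Fin 3))))
    (fun x => ∑ i : Fin 3, ‖G x (EuclideanSpace.single i (1:ℝ))‖ ^ 2) (ball (0 : EuclideanSpace ℝ (Fin 3)) r) hsi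
  have hball : s⁻¹ • ball (0 : EuclideanSpace ℝ (Fin 3)) r = ball 0 (r / s) := by
    rw [_root_.smul_ball hsi.ne', smul_zero, Real.norm_eq_abs, abs_of_pos hsi, div_eq_inv_mul]
  rw [hball, finrank_euclideanSpace_fin, smul_eq_mul] at hcov
  -- the integrand on the left: `dens (s⁻¹ • x) = s² · dens x` a.e. on `ball 0 r ⊆ Q`
  have hsub : ball (0 : EuclideanSpace ℝ (Fin 3)) r ⊆ {x : EuclideanSpace ℝ (Fin 3) | ∀ i : Fin 3, |x i| < 1} :=
    ball_subset_unitCube hr1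
  have hleft : ∫ x in ball (0 : EuclideanSpace ℝ (Fin 3)) r, ∑ i : Fin 3, ‖G (s⁻¹ • x) (EuclideanSpace.single i (1:ℝ))‖ ^ 2 =
      ∫ x in ball (0 : EuclideanSpace ℝ (Fin 3)) r, s ^ 2 * ∑ i : Fin 3, ‖G x (EuclideanSpace.single i (1:ℝ))‖ ^ 2 := by
    refine setIntegral_congr_ae measurableSet_ball ?_
    have h := ae_restrict_of_ae_restrict_of_subset hsub hhom
    rw [ae_restrict_iff' measurableSet_ball] at h
    filter_upwards [h] with x hx hxB
    rw [hx hxB, Finset.mul_sum]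
    refine Finset.sum_congr rfl fun i _ => ?_
    rw [_root_.smul_apply, norm_smul, mul_pow, Real.norm_eq_abs, sq_abs]
  rw [hleft, integral_const_mul] at hcov
  -- `s² · E(r) = s³ · E(r/s)`
  have h3 : ((s⁻¹) ^ 3)⁻¹ = s ^ 3 := by rw [inv_pow, inv_inv]
  rw [h3] at hcov
  have hs3 : s ^ 3 ≠ 0 := pow_ne_zero 3 hs0.ne'
  field_simp at hcov
  field_simp
  linarith [hcov]

/-- ★ **THE CENTRAL ENERGIES OF A RADIALLY CONSTANT CLASS MEMBER ARE LINEAR UP TO `r = 1`**: `E(B_r(0)) = E(B_1(0)) · r` for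
`0 < r ≤ 1`. [cite: Simon1996, §3.1] -/
theorem ballEnergy_linear
    {G : EuclideanSpace ℝ (Fin 3) → (EuclideanSpace ℝ (Fin 3) →L[ℝ] EuclideanSpace ℝ (Fin 4))}
    (hhom : ∀ s : ℝ, 1 ≤ s →
      ∀ᵐ x ∂(volume.restrict {x : EuclideanSpace ℝ (Fin 3) | ∀ i : Fin 3, |x i| < 1}), G (s⁻¹ • x) = s • G x)
    {r : ℝ} (hr : 0 < r) (hr1 : r ≤ 1) :
    ∫ x in ball (0 : EuclideanSpace ℝ (Fin 3)) r, ∑ i : Fin 3, ‖G x (EuclideanSpace.single i (1:ℝ))‖ ^ 2 =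
      (∫ x in ball (0 : EuclideanSpace ℝ (Fin 3)) 1, ∑ i : Fin 3, ‖G x (EuclideanSpace.single i (1:ℝ))‖ ^ 2) * r := by
  have h := ballEnergy_div (s := r⁻¹) (one_le_inv_iff₀.2 ⟨hr, hr1⟩) (hhom _ (one_le_inv_iff₀.2 ⟨hr, hr1⟩)) (r := 1) le_rfl
  rw [inv_inv, one_div, inv_inv] at h
  rw [h, mul_comm]

/-! ## §3 (GAP) ⟹ (TM) -/

/-- ★★★ **THE `8π`-GAP ROW IMPLIES SCHOEN–UHLENBECK's PROP. 1.2 ON THE CUBE.**  If every map of the vended class with LINEAR central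
energies of slope `Θ ≤ 3π` has `Θ = 0` (px3 g9's (GAP) text, VERBATIM), then every map of the class that is radially constant
(`G x x = 0` a.e. on `Q`) has `G = 0` a.e. on `Q` — i.e. the Literature named fact `MinimisingTangentMapConstant`
[SchoenUhlenbeck1984, Prop. 1.2].  Steps: degree-`(−1)` homogeneity of `G` (px14 g7) ⇒ exact linearity `E(B_r) = Θr` on `(0,1]`
(★ `ballEnergy_linear`) ⇒ `Θ ≤ 3π` by the hypothesis-free cap (px3 g9) ⇒ `Θ = 0` by (GAP) ⇒ `G = 0` a.e. on `B_1(0)` ⇒ on `Q` by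
homogeneity at `s = 2`. [cite: SchoenUhlenbeck1984, Prop. 1.2 and Lemma 1.1; Simon1996, §3.1] -/
theorem minimisingTangentMapConstant_of_gap
    (hGap : ∀ (hQ : IsOpen {x : EuclideanSpace ℝ (Fin 3) | ∀ i : Fin 3, |x i| < 1}) (U : EuclideanSpace ℝ (Fin 3) → EuclideanSpace ℝ (Fin 4)) (G : EuclideanSpace ℝ (Fin 3) → (EuclideanSpace ℝ (Fin 3) →L[ℝ] EuclideanSpace ℝ (Fin 4))),
      (HasWeakFDerivOn ⟨{x : EuclideanSpace ℝ (Fin 3) | ∀ i : Fin 3, |x i| < 1}, hQ⟩ volume U G ∧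
        (∀ x : EuclideanSpace ℝ (Fin 3), (∀ i : Fin 3, |x i| < 1) → ‖U x‖ = 1) ∧
        IntegrableOn (fun x => ∑ i : Fin 3, ‖G x (EuclideanSpace.single i (1:ℝ))‖ ^ 2) {x : EuclideanSpace ℝ (Fin 3) | ∀ i : Fin 3, |x i| < 1} ∧
        (∀ (y : EuclideanSpace ℝ (Fin 3)) (ρ : ℝ), 0 < ρ → closedBall y ρ ⊆ {x : EuclideanSpace ℝ (Fin 3) | ∀ i : Fin 3, |x i| < 1} →
          ∀ (W : EuclideanSpace ℝ (Fin 3) → EuclideanSpace ℝ (Fin 4)) (GW : EuclideanSpace ℝ (Fin 3) → (EuclideanSpace ℝ (Fin 3) →L[ℝ] EuclideanSpace ℝ (Fin 4))),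
          HasWeakFDerivOn ⟨{x : EuclideanSpace ℝ (Fin 3) | ∀ i : Fin 3, |x i| < 1}, hQ⟩ volume W GW →
          (∀ x : EuclideanSpace ℝ (Fin 3), (∀ i : Fin 3, |x i| < 1) → ‖W x‖ = 1) →
          IntegrableOn (fun x => ∑ i : Fin 3, ‖GW x (EuclideanSpace.single i (1:ℝ))‖ ^ 2) {x : EuclideanSpace ℝ (Fin 3) | ∀ i : Fin 3, |x i| < 1} →
          (∃ ρ' : ℝ, ρ' < ρ ∧ ∀ x : EuclideanSpace ℝ (Fin 3), x ∉ ball y ρ' → W x = U x) →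
          ∫ x in ball y ρ, ∑ i : Fin 3, ‖G x (EuclideanSpace.single i (1:ℝ))‖ ^ 2 ≤ ∫ x in ball y ρ, ∑ i : Fin 3, ‖GW x (EuclideanSpace.single i (1:ℝ))‖ ^ 2)) →
      ∀ Θ : ℝ, (∀ r : ℝ, 0 < r → r ≤ 1 / 2 → ∫ x in ball (0 : EuclideanSpace ℝ (Fin 3)) r, ∑ i : Fin 3, ‖G x (EuclideanSpace.single i (1:ℝ))‖ ^ 2 = Θ * r) →
        Θ ≤ 3 * Real.pi → Θ = 0) :
    Literature.Analysis.PDE.MinimisingTangentMapConstant := by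
  intro hQ U G hUG hrad
  obtain ⟨hU, hU1, hGi, hmin⟩ := hUG
  -- (1) homogeneity of degree `−1` on the star-shaped cube
  have hstar : ∀ x ∈ ((⟨{x : EuclideanSpace ℝ (Fin 3) | ∀ i : Fin 3, |x i| < 1}, hQ⟩ : Opens (EuclideanSpace ℝ (Fin 3))) :
      Set (EuclideanSpace ℝ (Fin 3))), ∀ s : ℝ, 1 ≤ s →
      s⁻¹ • x ∈ ((⟨{x : EuclideanSpace ℝ (Fin 3) | ∀ i : Fin 3, |x i| < 1}, hQ⟩ : Opens (EuclideanSpace ℝ (Fin 3))) :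
        Set (EuclideanSpace ℝ (Fin 3))) :=
    fun x hx s hs => inv_smul_mem_unitCube hx hs
  have hhom : ∀ s : ℝ, 1 ≤ s →
      ∀ᵐ x ∂(volume.restrict {x : EuclideanSpace ℝ (Fin 3) | ∀ i : Fin 3, |x i| < 1}), G (s⁻¹ • x) = s • G x :=
    fun s hs => ae_eq_smul_weakGrad_comp_inv_smul hstar hU hrad hs
  -- (2) exact linearity of the central energies, slope `Θ := E(B_1(0))`
  set Θ : ℝ := ∫ x in ball (0 : EuclideanSpace ℝ (Fin 3)) 1, ∑ i : Fin 3, ‖G x (EuclideanSpace.single i (1:ℝ))‖ ^ 2 with hΘ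
  have hlin : ∀ r : ℝ, 0 < r → r ≤ 1 →
      ∫ x in ball (0 : EuclideanSpace ℝ (Fin 3)) r, ∑ i : Fin 3, ‖G x (EuclideanSpace.single i (1:ℝ))‖ ^ 2 = Θ * r :=
    fun r hr hr1 => ballEnergy_linear hhom hr hr1
  -- (3) the density cap: `Θ ≤ 3π`
  have hcap : Θ ≤ 3 * Real.pi := by
    refine le_of_forall_pos_lt_add fun η hη => ?_
    obtain ⟨ρ, hρ0, hρ1, hρ⟩ := centralDensity_le_three_pi_holds hQ U G ⟨hU, hU1, hGi, hmin⟩ (η / 2) (by positivity)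
    rw [hlin ρ hρ0 hρ1.le] at hρ
    have hs : ρ⁻¹ * (Θ * ρ) = Θ := by field_simp
    rw [hs] at hρ
    linarith
  -- (4) the gap: `Θ = 0`, so the density vanishes a.e. on `ball 0 1`
  have hΘ0 : Θ = 0 := hGap hQ U G ⟨hU, hU1, hGi, hmin⟩ Θ (fun r hr hr2 => hlin r hr (by linarith)) hcap
  have hsub1 : ball (0 : EuclideanSpace ℝ (Fin 3)) 1 ⊆ {x : EuclideanSpace ℝ (Fin 3) | ∀ i : Fin 3, |x i| < 1} :=
    ball_subset_unitCube le_rfl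
  have hGiB : IntegrableOn (fun x => ∑ i : Fin 3, ‖G x (EuclideanSpace.single i (1:ℝ))‖ ^ 2)
      (ball (0 : EuclideanSpace ℝ (Fin 3)) 1) volume := hGi.mono_set hsub1
  have hdens0 : (fun x => ∑ i : Fin 3, ‖G x (EuclideanSpace.single i (1:ℝ))‖ ^ 2) =ᵐ[volume.restrict (ball (0 : EuclideanSpace ℝ (Fin 3)) 1)] 0 := by
    refine (setIntegral_eq_zero_iff_of_nonneg_ae ?_ hGiB).1 ?_
    · exact Filter.Eventually.of_forall fun x => Finset.sum_nonneg fun i _ => by positivity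
    · have h1 := hlin 1 one_pos le_rfl
      rw [hΘ0, zero_mul] at h1
      exact h1
  have hG0B : ∀ᵐ x ∂volume, x ∈ ball (0 : EuclideanSpace ℝ (Fin 3)) 1 → G x = 0 := by
    have h := hdens0
    rw [Filter.EventuallyEq, ae_restrict_iff' measurableSet_ball] at h
    filter_upwards [h] with x hx hxB
    exact eq_zero_of_sum_norm_sq_eq_zero (hx hxB)
  -- (5) back to the whole cube through the homothety `x ↦ 2⁻¹ • x`
  have hnull : volume {x : EuclideanSpace ℝ (Fin 3) | ¬ (x ∈ ball (0 : EuclideanSpace ℝ (Fin 3)) 1 → G x = 0)} = 0 := ae_iff.1 hG0B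
  have hpre : volume ((fun x : EuclideanSpace ℝ (Fin 3) => (2:ℝ)⁻¹ • x) ⁻¹'
      {x : EuclideanSpace ℝ (Fin 3) | ¬ (x ∈ ball (0 : EuclideanSpace ℝ (Fin 3)) 1 → G x = 0)}) = 0 := by
    rw [Measure.addHaar_preimage_smul volume (by norm_num : (2:ℝ)⁻¹ ≠ 0), hnull, mul_zero]
  have hG0half : ∀ᵐ x ∂volume, (2:ℝ)⁻¹ • x ∈ ball (0 : EuclideanSpace ℝ (Fin 3)) 1 → G ((2:ℝ)⁻¹ • x) = 0 := by
    rw [ae_iff]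
    exact measure_mono_null (fun x hx => hx) hpre
  have h2 := hhom 2 (by norm_num)
  rw [ae_restrict_iff' hQ.measurableSet] at h2 ⊢
  filter_upwards [h2, hG0half] with x hx hhalf hxQ
  have h0 : G ((2:ℝ)⁻¹ • x) = 0 := hhalf (half_smul_mem_ball hxQ)
  rw [hx hxQ] at h0
  exact (smul_eq_zero.1 h0).resolve_left (by norm_num)

/-! ## §4 Appendix — (TM) ⟸ (F) through ROAD (H)'s closer -/

/-- ★★ **(TM) ⟸ (F)**: Schoen–Uhlenbeck's Prop. 1.2 on the cube (the Literature named fact `MinimisingTangentMapConstant`) follows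
from the energy quantization of the H-system [BrezisCoron1985, Lemma A.1] ALONE — px19 g8's ROAD (H) closer
✓`PoincareLipschitzGapOfHSystemQuantizationCloses.gap_of_hSystemQuantization` (over px14 g7's (T)-door, px5 g9's (H)-door, px19's
(Q) and this seat's chart∕energy rows) composed with the bridge `minimisingTangentMapConstant_of_gap`. No harmonic-map regularity
is used anywhere. [cite: SchoenUhlenbeck1984, Prop. 1.2; BrezisCoron1985, Appendix, Lemma A.1] -/
theorem minimisingTangentMapConstant_of_hSystemQuantization
    (hF : Literature.Analysis.PDE.HSystemEnergyQuantization) :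
    Literature.Analysis.PDE.MinimisingTangentMapConstant :=
  minimisingTangentMapConstant_of_gap
    (Summit.QuantumFields.YangMills.Theorems.PoincareLipschitzGapOfHSystemQuantizationCloses.gap_of_hSystemQuantization hF)

end Summit.QuantumFields.YangMills.Theorems.PoincareLipschitzTangentMapConstantOfGap

end
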